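import Literature.NumberTheory.Irrationality.Zudilin2014.FirstTaleArithmetic
import Literature.NumberTheory.Irrationality.Zudilin2014.SecondTale

/-!
# Zudilin 2014, second tale: arithmetic of the blocks (Zudilin 2004, Lemmas 1–3)

Topic `Literature/NumberTheory/Irrationality/Zudilin2014` [Zudilin2014ZetaTwo, Section 6, eq. (T3)], whose
"standard consideration" is [Zudilin2004OddZeta, Lemmas 1–3].  PROVED here, for the blocks
`block lo hi = ∏_{lo≤i<hi} (X+i)` and `block2 lo hi = ∏_{lo≤ℓ<hi} (2X+ℓ)` of `R̂`:

* **the derivative of a block is a binomial combination of shorter blocks**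
  (`derivative_block_eq`): `d/dt ∏_{i<m}(t+lo+i) = Σ_{i<m} m!/(i!·(m−i)) · ∏_{i'<i}(t+lo+i')`, i.e. for the
  integer-valued polynomial `P_m(u) = u(u+1)⋯(u+m−1)/m!` the identity `P_m′ = Σ_{i=1}^{m} P_{m−i}/i`;
* hence **[Zudilin2004OddZeta, Lemma 1]**: `D_c · (block lo hi)′(u)/(hi−lo)! ∈ ℤ` for every integer `u` and
  `c ≥ hi − lo` (`exists_int_lcm_mul_derivative_block`), and the same for the doubled block at a point `t` with
  `2t ∈ ℤ` (`exists_int_lcm_mul_derivative_block2`, via `block2 = block ∘ (2X)`);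
* the **beta evaluation** `Σ_{i=0}^{r} (−1)^i binom(r,i)/(j+i+1) = j!·r!/(j+r+1)!` (`beta_sum`) and hence the
  Nikishin-type inclusion **[Zudilin2004OddZeta, Lemmas 2–3]** `D_c · j!·r!/(j+r+1)! ∈ ℤ` for `c ≥ j+r+1`
  (`exists_int_lcm_mul_beta`), which clears the reciprocal block `(b−a−1)!/∏_{a≤i<b}(i−k)` at an integer
  `k` outside `[a,b)`.
Small integrality helpers (private `exists_int_sum`, `exists_int_lcm_div_natCast`, `exists_int_lcm_div_intCast`) are
included for the companion file `SecondTaleArithmetic` (eq. (T3) and the `p̂`-half of Proposition 3).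

Cell pub-zeta5 (HONEST FRAMING: systematic search; no irrationality claim unless certified).
-/

noncomputable section

open Polynomial Finset
open Literature.NumberTheory.Transcendental (OddZeta.dvd_lcmUpto)

namespace Literature.NumberTheory.Irrationality.Zudilin2014

/-! ### Integrality helpers -/

/-- A finite sum of integers is an integer (bookkeeping for the inclusions of [Zudilin2014ZetaTwo, Prop. 3];
folklore — the same statement is `DilogPade.isInt_sum` in `DiophantineApproximation`, kept `private` here to avoid
a cross-topic import). [cite: Zudilin2014ZetaTwo, proof of Proposition 3] -/
private theorem exists_int_sum {ι : Type*} (s : Finset ι) (f : ι → ℚ) (h : ∀ i ∈ s, ∃ z : ℤ, f i = z) :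
    ∃ z : ℤ, ∑ i ∈ s, f i = z := by
  classical
  induction s using Finset.induction_on with
  | empty => exact ⟨0, by simp⟩
  | insert a s ha ih =>
    obtain ⟨z₁, hz₁⟩ := h a (mem_insert_self a s)
    obtain ⟨z₂, hz₂⟩ := ih fun i hi => h i (mem_insert_of_mem hi)
    exact ⟨z₁ + z₂, by rw [sum_insert ha, hz₁, hz₂]; push_cast; ring⟩

/-- `D_c / d ∈ ℤ` for `1 ≤ d ≤ c` ("definition of the least common multiple").
[cite: Zudilin2004OddZeta, proof of Lemma 4] -/
theorem exists_int_lcm_div_natCast {d c : ℕ} (h1 : 1 ≤ d) (h2 : d ≤ c) :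
    ∃ z : ℤ, (Nat.lcmUpto c : ℚ) / d = z := by
  obtain ⟨q, hq⟩ := OddZeta.dvd_lcmUpto h1 h2
  refine ⟨q, ?_⟩
  have hd : (d : ℚ) ≠ 0 := by exact_mod_cast (show d ≠ 0 by omega)
  rw [div_eq_iff hd, hq]; push_cast; ring

/-- `D_c / e ∈ ℤ` for a nonzero integer `e` with `|e| ≤ c`. [cite: Zudilin2004OddZeta, proof of Lemma 4] -/
theorem exists_int_lcm_div_intCast {e : ℤ} {c : ℕ} (h0 : e ≠ 0) (h : e.natAbs ≤ c) :
    ∃ z : ℤ, (Nat.lcmUpto c : ℚ) / (e : ℚ) = z := by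
  obtain ⟨z, hz⟩ := exists_int_lcm_div_natCast (Int.natAbs_pos.2 h0) h
  rcases Int.natAbs_eq e with he | he
  · refine ⟨z, ?_⟩
    rw [← hz]; congr 1; rw [he]; simp
  · refine ⟨-z, ?_⟩
    have : (e : ℚ) = -((e.natAbs : ℕ) : ℚ) := by
      rw [he]; push_cast; simp
    rw [this, div_neg, hz]; push_cast; ring

/-! ### The derivative of a block -/

/-- Appending one factor to a block: `block lo (hi+1) = block lo hi · (X + hi)` (`lo ≤ hi`).
[cite: Zudilin2004OddZeta, Lemma 1 (integer-valued polynomials)] -/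
theorem block_succ (lo hi : ℤ) (h : lo ≤ hi) : block lo (hi + 1) = block lo hi * (X + C ((hi : ℤ) : ℚ)) := by
  have h1 : block hi (hi + 1) = X + C ((hi : ℤ) : ℚ) := by
    unfold block
    have : Ico hi (hi + 1) = {hi} := by ext i; simp only [mem_Ico, mem_singleton]; omega
    rw [this, prod_singleton]
  rw [← block_mul_block h (by omega : hi ≤ hi + 1), h1]

/-- The empty block is `1`. [cite: Zudilin2004OddZeta, Lemma 1] -/
theorem block_self (lo : ℤ) : block lo lo = 1 := by
  unfold block; simp

/-- The coefficient `m!/(i!·(m−i))` of the derivative formula. [cite: Zudilin2004OddZeta, Lemma 1] -/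
def dcoef (m i : ℕ) : ℚ := (m.factorial : ℚ) / ((i.factorial : ℚ) * ((m : ℚ) - i))

/-- **Derivative of a block** [cite: Zudilin2004OddZeta, Lemma 1 (integer-valued polynomials)]:
`(block lo (lo+m))′ = Σ_{i<m} m!/(i!(m−i)) · block lo (lo+i)`, i.e. `P_m′ = Σ_{i=1}^{m} P_{m−i}/i` for
`P_m(u) = u(u+1)⋯(u+m−1)/m!`. -/
theorem derivative_block_eq (lo : ℤ) (m : ℕ) :
    derivative (block lo (lo + m)) = ∑ i ∈ range m, C (dcoef m i) * block lo (lo + i) := by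
  induction m with
  | zero => simp [block_self]
  | succ m ih =>
    have hs : block lo (lo + ((m + 1 : ℕ) : ℤ)) = block lo (lo + m) * (X + C (((lo + m : ℤ)) : ℚ)) := by
      have := block_succ lo (lo + m) (by omega)
      rw [← this]; congr 1; push_cast; ring
    rw [hs, derivative_mul, ih, derivative_add, derivative_X, derivative_C, add_zero, mul_one]
    -- shift the factor `(X + (lo+m))` into each shorter block
    have hshift : ∀ i ∈ range m, C (dcoef m i) * block lo (lo + i) * (X + C (((lo + m : ℤ)) : ℚ))
        = C (dcoef m i) * block lo (lo + ((i + 1 : ℕ) : ℤ)) + C (dcoef m i * ((m : ℚ) - i)) * block lo (lo + i) := by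
      intro i hi
      have hb : block lo (lo + ((i + 1 : ℕ) : ℤ)) = block lo (lo + i) * (X + C (((lo + i : ℤ)) : ℚ)) := by
        have := block_succ lo (lo + i) (by omega)
        rw [← this]; congr 1; push_cast; ring
      have hX : (X + C (((lo + m : ℤ)) : ℚ) : ℚ[X]) = (X + C (((lo + i : ℤ)) : ℚ)) + C ((m : ℚ) - i) := by
        rw [add_assoc, ← C_add]; congr 2; push_cast; ring
      rw [hb, hX, C_mul]; ring
    rw [sum_mul, sum_congr rfl hshift, sum_add_distrib]
    -- collect: Σ_{i<m} c_i B_{i+1} + (Σ_{i<m} c_i (m-i) B_i + B_m) = Σ_{i<m+1} c'_i B_i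
    have h2 : ∀ i ∈ range m, C (dcoef m i * ((m : ℚ) - i)) * block lo (lo + i)
        = C ((m.factorial : ℚ) / i.factorial) * block lo (lo + i) := by
      intro i hi
      have hmi : (m : ℚ) - i ≠ 0 := sub_ne_zero.2 (by exact_mod_cast (mem_range.1 hi).ne')
      congr 2; unfold dcoef; field_simp
    rw [sum_congr rfl h2]
    have h3 : ∑ i ∈ range m, C ((m.factorial : ℚ) / i.factorial) * block lo (lo + i) + block lo (lo + m)
        = ∑ i ∈ range (m + 1), C ((m.factorial : ℚ) / i.factorial) * block lo (lo + i) := by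
      rw [sum_range_succ]
      have : C ((m.factorial : ℚ) / m.factorial) = (1 : ℚ[X]) := by
        rw [div_self (by exact_mod_cast m.factorial_ne_zero), C_1]
      rw [this, one_mul]
    have h4 : ∑ i ∈ range m, C (dcoef m i) * block lo (lo + ((i + 1 : ℕ) : ℤ))
        = ∑ i ∈ range (m + 1), C (if i = 0 then 0 else dcoef m (i - 1)) * block lo (lo + i) := by
      rw [sum_range_succ']
      simp
    rw [add_assoc, h3, h4, ← sum_add_distrib]
    refine sum_congr rfl fun i hi => ?_
    rw [← add_mul, ← C_add]
    congr 2
    have him : i ≤ m := Nat.lt_succ_iff.1 (mem_range.1 hi)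
    rcases i with _ | i
    · simp only [zero_add, dcoef, Nat.factorial_zero, one_mul, Nat.cast_zero, sub_zero,
        div_one, Nat.factorial_succ, Nat.cast_mul, Nat.cast_succ]
      have hm1 : (m : ℚ) + 1 ≠ 0 := by positivity
      simp
      field_simp
    · simp only [Nat.succ_ne_zero, if_false, Nat.add_sub_cancel, dcoef]
      have hmi : (m : ℚ) - i ≠ 0 := sub_ne_zero.2 (by exact_mod_cast (show i < m by omega).ne')
      have hmi' : ((m + 1 : ℕ) : ℚ) - ((i + 1 : ℕ) : ℚ) = (m : ℚ) - i := by push_cast; ring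
      rw [hmi', Nat.factorial_succ m, Nat.factorial_succ i]
      push_cast
      field_simp
      ring

/-- Value of the derivative of a block at an integer:
`(block lo (lo+m))′(u) = Σ_{i<m} m!/(m−i) · binom(u+lo+i−1, i)`. [cite: Zudilin2004OddZeta, Lemma 1] -/
theorem eval_derivative_block_intCast (lo : ℤ) (m : ℕ) (u : ℤ) :
    (derivative (block lo (lo + m))).eval (u : ℚ)
      = ∑ i ∈ range m, (m.factorial : ℚ) / ((m : ℚ) - i) * (zb lo (lo + i) u : ℚ) := by
  rw [derivative_block_eq, eval_finsetSum]
  refine sum_congr rfl fun i hi => ?_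
  rw [eval_mul, eval_C, eval_block_intCast lo (lo + i) u (by omega)]
  have : (lo + (i : ℤ) - lo).toNat = i := by omega
  rw [this]; unfold dcoef
  have hi0 : (i.factorial : ℚ) ≠ 0 := by exact_mod_cast i.factorial_ne_zero
  field_simp

/-- **[Zudilin2004OddZeta, Lemma 1]** for a block of length `m`: `D_c · (block)′(u) ∈ m!·ℤ` for every integer
`u` and `c ≥ m`, i.e. `D_c P_m′(u) ∈ ℤ` for the integer-valued polynomial `P_m = block/m!`.
[cite: Zudilin2004OddZeta, Lemma 1] -/
theorem exists_int_lcm_mul_derivative_block_len (lo : ℤ) (m : ℕ) (u : ℤ) {c : ℕ} (hc : m ≤ c) :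
    ∃ z : ℤ, (Nat.lcmUpto c : ℚ) * (derivative (block lo (lo + m))).eval (u : ℚ) = (m.factorial : ℚ) * z := by
  rw [eval_derivative_block_intCast, mul_sum]
  have hterm : ∀ i ∈ range m, ∃ z : ℤ,
      (Nat.lcmUpto c : ℚ) * ((m.factorial : ℚ) / ((m : ℚ) - i) * (zb lo (lo + i) u : ℚ)) / m.factorial = z := by
    intro i hi
    have him := mem_range.1 hi
    obtain ⟨q, hq⟩ := exists_int_lcm_div_natCast (d := m - i) (c := c) (by omega) (by omega)
    refine ⟨q * zb lo (lo + i) u, ?_⟩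
    have hmi : ((m - i : ℕ) : ℚ) = (m : ℚ) - i := by push_cast [Nat.cast_sub him.le]; ring
    rw [hmi] at hq
    have hm0 : (m.factorial : ℚ) ≠ 0 := by exact_mod_cast m.factorial_ne_zero
    have hmi0 : (m : ℚ) - i ≠ 0 := sub_ne_zero.2 (by exact_mod_cast him.ne')
    push_cast; rw [← hq]; field_simp
  obtain ⟨z, hz⟩ := exists_int_sum (range m) _ hterm
  refine ⟨z, ?_⟩
  rw [← hz, mul_sum]
  refine sum_congr rfl fun i _ => ?_
  have hm0 : (m.factorial : ℚ) ≠ 0 := by exact_mod_cast m.factorial_ne_zero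
  field_simp

/-- **[Zudilin2004OddZeta, Lemma 1]**: `D_c · (block lo hi)′(u) ∈ (hi−lo)!·ℤ` for `lo ≤ hi`, every integer `u`
and `c ≥ hi − lo`. [cite: Zudilin2004OddZeta, Lemma 1] -/
theorem exists_int_lcm_mul_derivative_block {lo hi : ℤ} (h : lo ≤ hi) (u : ℤ) {c : ℕ}
    (hc : (hi - lo).toNat ≤ c) :
    ∃ z : ℤ, (Nat.lcmUpto c : ℚ) * (derivative (block lo hi)).eval (u : ℚ) = facZ (hi - lo) * z := by
  obtain ⟨z, hz⟩ := exists_int_lcm_mul_derivative_block_len lo (hi - lo).toNat u hc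
  have hhi : lo + ((hi - lo).toNat : ℤ) = hi := by omega
  rw [hhi] at hz
  exact ⟨z, by rw [facZ_eq, hz]⟩

/-! ### The doubled block -/

/-- `block2 = block ∘ (2X)`. [cite: Zudilin2014ZetaTwo, Section 6 (definition of R̂)] -/
theorem block2_eq_comp (lo hi : ℤ) : block2 lo hi = (block lo hi).comp (C (2 : ℚ) * X) := by
  unfold block2 block
  rw [Polynomial.prod_comp]
  refine prod_congr rfl fun i _ => ?_
  rw [add_comp, X_comp, C_comp]

/-- `block2(t) = block(2t)`. [cite: Zudilin2014ZetaTwo, Section 6 (definition of R̂)] -/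
theorem eval_block2_eq (lo hi : ℤ) (t : ℚ) : (block2 lo hi).eval t = (block lo hi).eval (2 * t) := by
  rw [block2_eq_comp, eval_comp]; simp

/-- `block2′(t) = 2·block′(2t)`. [cite: Zudilin2014ZetaTwo, Section 6, eq. (T3a)] -/
theorem eval_derivative_block2_eq (lo hi : ℤ) (t : ℚ) :
    (derivative (block2 lo hi)).eval t = 2 * (derivative (block lo hi)).eval (2 * t) := by
  rw [block2_eq_comp, derivative_comp]; simp [eval_comp]

/-- **[Zudilin2004OddZeta, Lemma 1] for the doubled block**: if `2t ∈ ℤ` then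
`D_c · (block2 lo hi)′(t) ∈ (hi−lo)!·ℤ` for `c ≥ hi − lo`. [cite: Zudilin2004OddZeta, Lemma 1] -/
theorem exists_int_lcm_mul_derivative_block2 {lo hi : ℤ} (h : lo ≤ hi) {t : ℚ} {s : ℤ} (hs : 2 * t = s)
    {c : ℕ} (hc : (hi - lo).toNat ≤ c) :
    ∃ z : ℤ, (Nat.lcmUpto c : ℚ) * (derivative (block2 lo hi)).eval t = facZ (hi - lo) * z := by
  obtain ⟨z, hz⟩ := exists_int_lcm_mul_derivative_block h s hc
  refine ⟨2 * z, ?_⟩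
  rw [eval_derivative_block2_eq, hs, mul_left_comm, hz]; push_cast; ring

/-! ### The beta evaluation (Nikishin's lemma for one block) -/

/-- **Beta evaluation** `Σ_{i=0}^{r} (−1)^i binom(r,i)/(j+i+1) = j!·r!/(j+r+1)!` (the partial fractions of
`r!/((x+j+1)(x+j+2)⋯(x+j+r+1))` at `x = 0`). [cite: Zudilin2004OddZeta, Lemma 2 (Nikishin's scheme)] -/
theorem beta_sum (j r : ℕ) :
    ∑ i ∈ range (r + 1), (-1 : ℚ) ^ i * (r.choose i : ℚ) / ((j : ℚ) + i + 1)
      = (j.factorial : ℚ) * r.factorial / (j + r + 1).factorial := by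
  induction r generalizing j with
  | zero =>
    simp [Nat.factorial_succ]
    field_simp
  | succ r ih =>
    -- Pascal: binom(r+1,i+1) = binom(r,i) + binom(r,i+1)
    rw [Finset.sum_range_succ' (fun i => (-1 : ℚ) ^ i * ((r + 1).choose i : ℚ) / ((j : ℚ) + i + 1)),
      Nat.choose_zero_right]
    have hsplit : ∑ i ∈ range (r + 1), (-1 : ℚ) ^ (i + 1) * ((r + 1).choose (i + 1) : ℚ) / ((j : ℚ) + ((i + 1 : ℕ) : ℚ) + 1)
        = -(∑ i ∈ range (r + 1), (-1 : ℚ) ^ i * (r.choose i : ℚ) / (((j + 1 : ℕ) : ℚ) + i + 1))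
          + ∑ i ∈ range (r + 1), (-1 : ℚ) ^ (i + 1) * (r.choose (i + 1) : ℚ) / ((j : ℚ) + ((i + 1 : ℕ) : ℚ) + 1) := by
      rw [← sum_neg_distrib, ← sum_add_distrib]
      refine sum_congr rfl fun i _ => ?_
      rw [Nat.choose_succ_succ', Nat.cast_add]
      push_cast; ring
    rw [hsplit, ih (j + 1)]
    -- the second sum together with the `i = 0` term is the old sum (last binomial vanishes)
    have htail : (-1 : ℚ) ^ 0 * ((1 : ℕ) : ℚ) / ((j : ℚ) + ((0 : ℕ) : ℚ) + 1)
        + ∑ i ∈ range (r + 1), (-1 : ℚ) ^ (i + 1) * (r.choose (i + 1) : ℚ) / ((j : ℚ) + ((i + 1 : ℕ) : ℚ) + 1)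
        = ∑ i ∈ range (r + 1), (-1 : ℚ) ^ i * (r.choose i : ℚ) / ((j : ℚ) + i + 1) := by
      have e : ∑ i ∈ range (r + 1 + 1), (-1 : ℚ) ^ i * (r.choose i : ℚ) / ((j : ℚ) + i + 1)
          = ∑ i ∈ range (r + 1), (-1 : ℚ) ^ i * (r.choose i : ℚ) / ((j : ℚ) + i + 1) := by
        rw [sum_range_succ, Nat.choose_succ_self]; simp
      rw [← e, Finset.sum_range_succ' (fun i => (-1 : ℚ) ^ i * (r.choose i : ℚ) / ((j : ℚ) + i + 1))]
      simp only [Nat.choose_zero_right, pow_zero, Nat.cast_zero, add_zero, Nat.cast_one]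
      rw [add_comm]
    have hfin : -(((j + 1).factorial : ℚ) * r.factorial / (j + 1 + r + 1).factorial)
        + (j.factorial : ℚ) * r.factorial / (j + r + 1).factorial
        = (j.factorial : ℚ) * (r + 1).factorial / (j + r + 1 + 1).factorial := by
      have e1 : (((j + 1 + r + 1).factorial : ℕ) : ℚ) = ((j : ℚ) + r + 2) * (j + r + 1).factorial := by
        rw [show j + 1 + r + 1 = (j + r + 1) + 1 by omega, Nat.factorial_succ]; push_cast; ring
      have e2 : (((j + r + 1 + 1).factorial : ℕ) : ℚ) = ((j : ℚ) + r + 2) * (j + r + 1).factorial := by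
        rw [Nat.factorial_succ]; push_cast; ring
      have e3 : (((j + 1).factorial : ℕ) : ℚ) = ((j : ℚ) + 1) * j.factorial := by
        rw [Nat.factorial_succ]; push_cast; ring
      have e4 : (((r + 1).factorial : ℕ) : ℚ) = ((r : ℚ) + 1) * r.factorial := by
        rw [Nat.factorial_succ]; push_cast; ring
      rw [e1, e2, e3, e4]
      have h1 : ((j + r + 1).factorial : ℚ) ≠ 0 := by exact_mod_cast (j + r + 1).factorial_ne_zero
      have h2 : (j : ℚ) + r + 2 ≠ 0 := by positivity
      field_simp
      ring
    linear_combination htail + ih j + hfin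

/-- **Nikishin-type inclusion** [cite: Zudilin2004OddZeta, Lemmas 2–3]: `D_c · j!·r!/(j+r+1)! ∈ ℤ` for
`c ≥ j + r + 1`; this clears the reciprocal block `(b−a−1)!/∏_{a≤i<b}(i−k)` at an integer `k ∉ [a,b)`
(`j = a−1−k`, `r = b−a−1` if `k < a`; `j = b−a−1`, `r = k−b` if `k ≥ b`). -/
theorem exists_int_lcm_mul_beta (j r : ℕ) {c : ℕ} (hc : j + r + 1 ≤ c) :
    ∃ z : ℤ, (Nat.lcmUpto c : ℚ) * ((j.factorial : ℚ) * r.factorial / (j + r + 1).factorial) = z := by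
  rw [← beta_sum, mul_sum]
  refine exists_int_sum _ _ fun i hi => ?_
  have hir := mem_range.1 hi
  obtain ⟨q, hq⟩ := exists_int_lcm_div_natCast (d := j + i + 1) (c := c) (by omega) (by omega)
  refine ⟨(-1) ^ i * (r.choose i) * q, ?_⟩
  have : ((j + i + 1 : ℕ) : ℚ) = (j : ℚ) + i + 1 := by push_cast; ring
  rw [this] at hq
  push_cast; rw [← hq]; ring

end Literature.NumberTheory.Irrationality.Zudilin2014

end
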